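import Literature.MathematicalPhysics.QuantumFieldTheory.Balaban1983to89.BlockAveragingHaarAC
import Literature.MathematicalPhysics.QuantumFieldTheory.Balaban1983to89.LatticeWordStokes
import Summits.QuantumFields.BalabanUV.T4Continuum.Support.B13AvgCorrStokesVariation
import Summits.QuantumFields.BalabanUV.T4Continuum.Support.B13AvgCorrStokesLoop
import Summits.QuantumFields.BalabanUV.T4Continuum.Spine.NE7.QLaAbelianBlockModel
import HarnessLib

/-!
# DAG node N07 [B11] — Sect. F (160) CASE II, SECOND HALF: from the (0.4)-family transporters to EVERY CROSSING BOND `b ∈ B(c)` of the block pair —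
# Lemma 1 of [6] (1.25) «for an arbitrary bond b ∈ B(c)» in the (0.4) reading, generic gauge group, hypothesis-form block-wise gauge; pure lattice-walk
# bookkeeping on the tree's (0.3)–(0.4) words (the `SU(N)` ∕ record assembly with the first half p607031 is the sequel file `…CrossingBondsAtRecord`)

Cell `pub-ymgap` (HUMAN RULINGS D-0062 ∕ D-0149 ∕ D-0154), width seat `pub-ymgap-dag-n07-w5` g0, 2026-08-28.  `--kind proof --supports
stmt-QuantumFields-20542 --as helper` (K1⁷; count-neutral helper on the N07 [B11] row; dag-lead WIDTH-209 N07 piece 1b «(160) CASE II + (155) far-field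
at the record», DEDUP-382; second file of this seat, sequel of p607031).

THE PRINT.
* [6] = T. Bałaban, *Spaces of regular gauge field configurations on a lattice and gauge fixing conditions*, Commun. Math. Phys. **99** (1985) 75–102
  `[Balaban1985RegularSpaces]`, Lemma 1 (1.24)–(1.25) p. 79 «|V′ − 1| < 4d²α₀ + α₁ on Ω₁» and its proof, p. 79 l. −6 – p. 80 l. 4: «The conditions
  (R₀V′)(Γ_{y,x}) = 1, x ∈ B(y), imply V′_b = 1 for b ⊂ Γ_{y,x}. This and the above estimate imply |V′_b − 1| < (d−1)(L−1)2α₀L⁻² for b ⊂ B(y) … Thus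
  |R(V₀(Γ_{b₀,−,b₋}))V′_b − V′_{b₀}| < (d−1)(L−1)4dα₀L⁻¹ < 4(d−1)dα₀ for an arbitrary bond b ∈ B(c) and b₀ being the unique bond of c belonging to
  B(c) … hence finally we have the bound (1.25) for an arbitrary bond b.»; (1.23) p. 79 «B(c) = {b ⊂ T : b₋ ∈ B(c₋), b₊ ∈ B(c₊)}».
* [B11] = T. Bałaban, CMP **102** (1985) 277–309 `[Balaban1985Variational]`, (160) p. 303 second case «If ⟨x, x′⟩ ⊂ □̃′_k^{(k)}, then we apply the Lemma 1
  of [6] … The lemma implies that |V₁(x₁, x′₁) − 1| < 4d²L²ε₁ + |x − y|2L²ε₁ for ⟨x₁, x′₁⟩ ⊂ B(x) ∪ B(x′), hence |B(x₁, x′₁)| < 8d²L²ε₁ + |x − y|4L²ε₁.»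
* [I] = T. Bałaban, CMP **109** (1987) 249–301 `[Balaban1987RG1]`, (0.3)–(0.4) pp. 252–253 (staircases `Γ ∈ G(y,x)`, loops `Γ ∪ [x,x′] ∪ (−Γ′) ∪ (−c)`).

WHY THIS FILE.  The first half (p607031) bounds, for the (0.4) averaging, the straight transporter `U(Γ_c)`, the central crossing bond `β(c)` and EVERY
(0.4)-family transporter `U(Γ ∪ [x, x′] ∪ (−Γ′))` from centre to centre by `dist1 (Ū(c)) + 6t` ∕ `+ 7t`.  Print's (1.25) ∕ (160)-II is a statement about
EVERY bond `b ∈ B(c)`.  In a block-wise axial gauge ([6] (1.15)∕(1.19); at the record: pv26's `T4AxialGaugeSmallField.axialGauge` per block, normalised at the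
centre) the bonds INSIDE a block are small by plaquettes alone; what remains is the CROSSING bonds other than `β(c)`, and for them the (0.4) family already
contains the right transporter: taking `x` ON THE FAR FACE of `B(c₋)` (`r_μ = L − 1`) the segment `[x, x′]` STARTS with the crossing bond `⟨x, μ⟩`, so
`U(⟨x, μ⟩) = U(Γ)⁻¹ · U(Γ ∪ [x, x′] ∪ (−Γ′)) · U([x + e_μ, x′] ∪ (−Γ′))⁻¹` with `Γ` inside `B(c₋)` and `[x + e_μ, x′] ∪ (−Γ′)` inside `B(c₊)` — at most
`d(L−1)∕2 + (L−1) + d(L−1)∕2 ≤ (d+1)(L−1)` within-block bonds.  Every crossing bond of `B(c)` is such an `⟨x, μ⟩` (§6).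

WHAT THIS FILE DOES (kernel bookkeeping; no estimate of [B11] ∕ [6] beyond Lemma 1's elementary counting is asserted).  Generic torus `P : Params`,
standing range `j + 1 ≤ m + K`; EVERY gauge group `G` throughout.
* §1 ★ `dist1_holAt_le_length_mul` (a transporter along
  steps whose bond variables are `τ`-close to `1` is `(#steps)·τ`-close to `1` — print's «V′_b = 1 for b ⊂ Γ_{y,x} … by the same reasoning»).
* §2 ★ `blockOf_src_tgt_of_mem_walk_stairWord` — BOTH ends of every bond of a centred staircase `Γ ∈ G(y, x)` (`|n_ν| ≤ (L−1)∕2`) lie in `B(y)`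
  (`BlockAveragingHaarAC.exists_take_of_mem_walk` + `T4Continuum.netDisp_take_stairWord` + `blockOf_eq_of_near_emb`).
* §3 (`Γ` ends at `Site.blockSite y r`: NE7's `walkEnd_emb_stairWord` by name) ★ `blockOf_src_tgt_of_mem_walk_run` (the run of `L − 1` steps `+e_μ`
  entering `B(c₊)` at its near face stays inside `B(c₊)`, both ends), `walkEnd_run_eq_walkEnd_stairWord` (it ends where `Γ′` from the centre of `B(c₊)` ends).
* §4 `openHol_eq_mul_bond_mul` (the factorisation above, every index), `dist1_mid_le` (`|B − 1| ≤ |A − 1| + |ABC − 1| + |C − 1|`), ★★★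
  `dist1_crossingBond_le_openHol_add`: under `hint` («every fine bond with both ends in `B(c₋)` or both in `B(c₊)` is `τ`-close to `1`»), for `x = blockSite c₋ r`
  with `r_μ = L − 1`: `dist1 (U⟨x, μ⟩) ≤ dist1 (U(Γ ∪ [x, x′] ∪ (−Γ′))) + (d + 1)(L − 1)·τ`.
* §6 `blockSite_shift_of_lt`, ★ `exists_offset_of_crossing` (a bond `b ∥ c` with `blockOf b₋ = c₋`, `blockOf b₊ ≠ c₋` IS `⟨blockSite c₋ r, μ⟩` with
  `r_μ = L − 1`, by `Site.blockEquiv`), ★★ `dist1_crossingBond_le_openHol_add'` (the `b`-keyed form of §4 for every `b ∈ B(c)` in print's sense (1.23)).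

HONEST FRAMING (binding).  Count-neutral helper; lattice-walk bookkeeping over landed objects; the within-block smallness `τ` is a HYPOTHESIS
(the block-wise axial gauge is the consumer's: pv26 `dist1_gaugeAct_axialGauge_le_uniform` per block gives `τ = (d−1)(L−1)·a`; its centre-normalised global
assembly is NOT constructed here); the size of the (0.4)-family transporter is the sequel's input (p607031 §4); the interior bonds themselves, the
far-field (155) and the Landau re-gauging `u` ∕ its shear are NOT here ((156) stays GAP-STATED(avg-universality)); which road consumes the datum is the
planners' word.  Constants are the tree's crude counts (`(d+1)(L−1)τ`), not print's `4d²α₀`.  Tokens ∕ stub 1 ∕ K0⁷ ∕ K1⁷ NOT closed; N07 NOT discharged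
(5∕27 unmoved); one finite `T⁴` programme at fixed `ε`, Bałaban AS PRINTED — R4 closes rung `BalabanLadder.UV` only; no summit statement is proved by this
seat; NOT continuum ∕ ℝ⁴ ∕ OS ∕ mass gap ∕ Clay.  No `sorry`, no `def`, no `instance`, no `notation`.
-/

noncomputable section

namespace Summit.QuantumFields.YangMills.BalabanUVNodes.N07Lemma1CrossingBonds

open Literature.MathematicalPhysics.QuantumFieldTheory.Balaban1983to89
open T4Continuum AveragingRT BlockAveraging
open BlockAveragingHaarAC (openWord openHol exists_take_of_mem_walk mem_walk_replicate flip_mem_walk_of_mem_walk_wordRev)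
open T4ReflectionCone (netDisp_replicate netDisp_append)

/-! ## §1  Walks all of whose bonds are `τ`-close to `1` -/

section Walks

variable {P : Params} {j : ℕ} {G : Type*} [GaugeGroup G]

/-- **A transporter along steps whose bond variables are all `τ`-close to `1` is `(#steps)·τ`-close to `1`** (`dist1_mul_le`, `dist1_inv`).
[cite: Balaban1985RegularSpaces, p.79 (proof of Lemma 1, «by the same reasoning as in [3] (between (44) and (46))»)] -/
theorem dist1_holAt_le_length_mul (U : GaugeField P j G) {τ : ℝ} (hτ : 0 ≤ τ) :
    ∀ γ : List (LStep P j), (∀ s ∈ γ, dist1 (U s.bond) ≤ τ) → dist1 (holAt U γ) ≤ γ.length * τ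
  | [], _ => by simp [holAt_nil, GaugeGroup.dist1_one]
  | s :: γ, h => by
    rw [holAt_cons, List.length_cons]
    have hs : dist1 (if s.fwd then U s.bond else (U s.bond)⁻¹) ≤ τ := by
      split_ifs
      · exact h s (List.mem_cons_self)
      · rw [GaugeGroup.dist1_inv]; exact h s (List.mem_cons_self)
    have ih := dist1_holAt_le_length_mul U hτ γ (fun s' hs' => h s' (List.mem_cons_of_mem _ hs'))
    calc dist1 ((if s.fwd then U s.bond else (U s.bond)⁻¹) * holAt U γ)
          ≤ dist1 (if s.fwd then U s.bond else (U s.bond)⁻¹) + dist1 (holAt U γ) := GaugeGroup.dist1_mul_le _ _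
      _ ≤ τ + γ.length * τ := add_le_add hs ih
      _ = ((γ.length + 1 : ℕ) : ℝ) * τ := by push_cast; ring

end Walks

/-! ## §2  Staircases from a block centre stay inside the block (both ends of every bond) -/

section Stairs

variable {P : Params} {j : ℕ}

/-- **BOTH ENDS OF EVERY BOND OF A CENTRED STAIRCASE LIE IN THE BLOCK**: for offsets `|n_ν| ≤ (L−1)∕2` every step of the staircase
walk `Γ ∈ G(y, x)` of [I] (0.3) from the centre `emb y` has source AND target in `B(y)` (prefix box `netDisp_take_stairWord` +
`blockOf_eq_of_near_emb`; standing range). [cite: Balaban1987RG1, (0.3) p.252] -/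
theorem blockOf_src_tgt_of_mem_walk_stairWord (hj : j + 1 ≤ P.m + P.K) (y : Site P (j + 1)) (σ : Equiv.Perm (Fin P.d))
    (n : Fin P.d → ℤ) (hn : ∀ κ, -(((P.L - 1) / 2 : ℕ) : ℤ) ≤ n κ ∧ n κ ≤ (((P.L - 1) / 2 : ℕ) : ℤ))
    {s : LStep P j} (hs : s ∈ walk (emb y) (stairWord σ n)) :
    blockOf s.bond.src = y ∧ blockOf s.bond.tgt = y := by
  obtain ⟨k₁, k₂, h1, h2⟩ := exists_take_of_mem_walk (emb y) (stairWord σ n) s hs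
  have hbox : ∀ k κ, -(((P.L - 1) / 2 : ℕ) : ℤ) ≤ netDisp ((stairWord σ n).take k) κ ∧
      netDisp ((stairWord σ n).take k) κ ≤ (((P.L - 1) / 2 : ℕ) : ℤ) := by
    intro k κ
    have h := netDisp_take_stairWord σ n κ k
    have hκ := hn κ
    have hlo : -(((P.L - 1) / 2 : ℕ) : ℤ) ≤ min 0 (n κ) := le_min (by omega) hκ.1
    have hhi : max 0 (n κ) ≤ (((P.L - 1) / 2 : ℕ) : ℤ) := max_le (by positivity) hκ.2
    exact ⟨hlo.trans h.1, h.2.trans hhi⟩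
  refine ⟨blockOf_eq_of_near_emb hj y s.bond.src _ h1 (hbox k₁), ?_⟩
  refine blockOf_eq_of_near_emb hj y s.bond.tgt (fun κ => netDisp ((stairWord σ n).take k₂) κ) (fun ν => ?_) (hbox k₂)
  rw [PBond.tgt, Site.shift_apply]
  by_cases hν : ν = s.bond.dir
  · subst hν
    rw [if_pos rfl, h1, h2, if_pos rfl]
    push_cast
    ring
  · rw [if_neg hν, h1 ν, h2 ν, if_neg hν, add_zero]

end Stairs


/-! ## §3  The straight run through `B(c₊)` and the block-site dictionary -/

section Run

variable {P : Params} {j : ℕ}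

/-- **EVERY BOND OF THE STRAIGHT RUN OF `L − 1` STEPS `+e_μ` ENTERING `B(c₊)` AT ITS NEAR FACE LIES INSIDE `B(c₊)`** (both ends): the run
starts at `x + e_μ` where `x = emb c₋ + n` is on the far face of `B(c₋)` (`n_μ = (L−1)∕2`), so its sites have `μ`-offsets
`−(L−1)∕2, …, (L−1)∕2` from the centre of `B(c₊)` and transverse offsets `n_ν` (standing range). [cite: Balaban1987RG1, (0.3)-(0.4) pp.252-253] -/
theorem blockOf_src_tgt_of_mem_walk_run (hj : j + 1 ≤ P.m + P.K) (c : PBond P (j + 1)) (n : Fin P.d → ℤ)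
    (hn : ∀ κ, -(((P.L - 1) / 2 : ℕ) : ℤ) ≤ n κ ∧ n κ ≤ (((P.L - 1) / 2 : ℕ) : ℤ)) (hμ : n c.dir = (((P.L - 1) / 2 : ℕ) : ℤ))
    {x : Site P j} (hx : ∀ ν, x ν = emb c.src ν + ((n ν : ℤ) : ZMod (P.sitesPerDir j)))
    {s : LStep P j} (hs : s ∈ walk (x.shift c.dir) (List.replicate (P.L - 1) (c.dir, true))) :
    blockOf s.bond.src = c.tgt ∧ blockOf s.bond.tgt = c.tgt := by
  have hL := AveragingRT.two_mul_half_add_one P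
  obtain ⟨hdir, -, t', ht', hsrc⟩ := mem_walk_replicate hs
  -- coordinates of the run's base relative to the centre of `B(c₊)`
  have hx₁ : ∀ ν, (x.shift c.dir) ν = emb c.tgt ν +
      (((if ν = c.dir then -(((P.L - 1) / 2 : ℕ) : ℤ) else n ν : ℤ)) : ZMod (P.sitesPerDir j)) := by
    intro ν
    rw [Site.shift_apply, PBond.tgt, emb_shift_apply]
    by_cases hν : ν = c.dir
    · subst hν
      rw [if_pos rfl, if_pos rfl, if_pos rfl, hx, hμ]
      have h2 : (((P.L - 1) / 2 : ℕ) : ℤ) + 1 = (P.L : ℤ) - (((P.L - 1) / 2 : ℕ) : ℤ) := by omega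
      have h3 : (((((P.L - 1) / 2 : ℕ) : ℤ)) : ZMod (P.sitesPerDir j)) + 1 =
          (P.L : ZMod (P.sitesPerDir j)) - ((((P.L - 1) / 2 : ℕ) : ℤ) : ZMod (P.sitesPerDir j)) := by
        have := congrArg (fun z : ℤ => (z : ZMod (P.sitesPerDir j))) h2
        push_cast at this ⊢
        exact this
      push_cast at h3 ⊢
      linear_combination h3
    · rw [if_neg hν, if_neg hν, if_neg hν, hx ν, add_zero]
  -- the source: μ-offset `−(L−1)/2 + t′`, transverse offsets `n_ν`
  set e : Fin P.d → ℤ := fun ν => (if ν = c.dir then -(((P.L - 1) / 2 : ℕ) : ℤ) else n ν) + (if ν = c.dir then (t' : ℤ) else 0)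
    with he
  have hsrc' : ∀ ν, s.bond.src ν = emb c.tgt ν + ((e ν : ℤ) : ZMod (P.sitesPerDir j)) := by
    intro ν
    rw [hsrc ν, hx₁ ν, he]
    push_cast
    ring
  have hebox : ∀ ν, -(((P.L - 1) / 2 : ℕ) : ℤ) ≤ e ν ∧ e ν ≤ (((P.L - 1) / 2 : ℕ) : ℤ) := by
    intro ν
    by_cases hν : ν = c.dir
    · simp only [he, hν, if_true]; constructor <;> omega
    · simp only [he, hν, if_false, add_zero]; exact hn ν
  refine ⟨blockOf_eq_of_near_emb hj c.tgt s.bond.src e hsrc' hebox, ?_⟩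
  refine blockOf_eq_of_near_emb hj c.tgt s.bond.tgt (fun ν => e ν + if ν = c.dir then 1 else 0) (fun ν => ?_) (fun ν => ?_)
  · rw [PBond.tgt, Site.shift_apply, hdir]
    by_cases hν : ν = c.dir
    · subst hν
      rw [if_pos rfl, hsrc', if_pos rfl]
      push_cast
      ring
    · rw [if_neg hν, hsrc' ν, if_neg hν, add_zero]
  · by_cases hν : ν = c.dir
    · simp only [he, hν, if_true]; constructor <;> omega
    · simp only [he, hν, if_false, add_zero]; exact hn ν

/-- The run of `L − 1` steps from `x + e_μ` ends where the staircase `Γ′ ∈ G(c₊, x′)` from the centre of `B(c₊)` ends (`x′ = x + L e_μ`).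
[cite: Balaban1987RG1, (0.4) p.253] -/
theorem walkEnd_run_eq_walkEnd_stairWord (c : PBond P (j + 1)) (n : Fin P.d → ℤ) (σ' : Equiv.Perm (Fin P.d))
    {x : Site P j} (hx : ∀ ν, x ν = emb c.src ν + ((n ν : ℤ) : ZMod (P.sitesPerDir j))) :
    walkEnd (x.shift c.dir) (List.replicate (P.L - 1) (c.dir, true)) = walkEnd (emb c.tgt) (stairWord σ' n) := by
  have hL := AveragingRT.two_mul_half_add_one P
  have hL1 : (((P.L - 1 : ℕ) : ℤ)) = (P.L : ℤ) - 1 := by have := P.hL.2; omega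
  funext ν
  rw [walkEnd_apply, walkEnd_apply, netDisp_replicate, netDisp_stairWord, Site.shift_apply, PBond.tgt, emb_shift_apply]
  by_cases hν : ν = c.dir
  · subst hν
    simp only [if_true, hx, hL1]
    push_cast
    ring
  · simp only [hν, Ne.symm hν, if_false, hx ν, mul_zero, Int.cast_zero, add_zero]

end Run


/-! ## §4  THE CROSSING BONDS: `U(b) = U(Γ)⁻¹ · U(Γ ∪ [x,x′] ∪ (−Γ′)) · U([x+e_μ, x′] ∪ (−Γ′))⁻¹` and the bound -/

section Crossing

variable {P : Params} {j : ℕ} {G : Type*} [GaugeGroup G]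

/-- **THE OPEN TRANSPORTER OF (0.4) FACTORS THROUGH THE FIRST BOND OF ITS SEGMENT**: for every index `(r, σ, σ′)`,
`U(Γ ∪ [x, x′] ∪ (−Γ′)) = U(Γ) · U(⟨x, μ⟩) · U([x + e_μ, x′] ∪ (−Γ′))`, `x = blockSite c₋ r` (`walk_append`, `holAt_append`; no face
condition needed here). [cite: Balaban1987RG1, (0.4) p.253] -/
theorem openHol_eq_mul_bond_mul (U : GaugeField P j G) (c : PBond P (j + 1)) (r : Fin P.d → Fin P.L)
    (σ σ' : Equiv.Perm (Fin P.d)) :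
    openHol U c (r, σ, σ') =
      holAt U (walk (emb c.src) (stairWord σ (off r))) *
        ((U ⟨Site.blockSite c.src r, c.dir⟩) *
          holAt U (walk ((Site.blockSite c.src r).shift c.dir)
            (List.replicate (P.L - 1) (c.dir, true) ++ wordRev (stairWord σ' (off r))))) := by
  have hrep : (List.replicate P.L ((c.dir, true) : Letter P.d)) = (c.dir, true) :: List.replicate (P.L - 1) (c.dir, true) := by
    rw [← List.replicate_succ]
    congr 1
    have := P.hL.2
    omega
  show holAt U (walk (emb c.src) (openWord P.L c.dir (off r) σ σ')) = _
  rw [openWord, hrep, walk_append, holAt_append, Summit.QuantumFields.BalabanUV.T4Continuum.Spine.NE7.walkEnd_emb_stairWord,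
    List.cons_append]
  show _ * holAt U (⟨⟨Site.blockSite c.src r, c.dir⟩, true⟩ ::
      walk ((Site.blockSite c.src r).shift c.dir) (List.replicate (P.L - 1) (c.dir, true) ++ wordRev (stairWord σ' (off r)))) = _
  rw [holAt_cons]
  simp

/-- Group bookkeeping: `B = A⁻¹ (A B C) C⁻¹`, so `|B − 1| ≤ |A − 1| + |ABC − 1| + |C − 1|`. [folklore] -/
theorem dist1_mid_le (A B C : G) : dist1 B ≤ dist1 A + dist1 (A * (B * C)) + dist1 C := by
  have h : B = A⁻¹ * (A * (B * C)) * C⁻¹ := by group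
  have h₀ : dist1 B = dist1 (A⁻¹ * (A * (B * C)) * C⁻¹) := congrArg dist1 h
  have h₁ : dist1 (A⁻¹ * (A * (B * C)) * C⁻¹) ≤ dist1 (A⁻¹ * (A * (B * C))) + dist1 C⁻¹ := GaugeGroup.dist1_mul_le _ _
  have h₂ : dist1 (A⁻¹ * (A * (B * C))) ≤ dist1 A⁻¹ + dist1 (A * (B * C)) := GaugeGroup.dist1_mul_le _ _
  rw [GaugeGroup.dist1_inv] at h₁ h₂
  linarith

/-- ★★★ **LEMMA 1 OF [6] (1.25) FOR AN ARBITRARY CROSSING BOND `b ∈ B(c)`, (0.4) READING, hypothesis-form block-wise gauge.**  Let `c = ⟨y, y + e_μ⟩`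
be a coarse bond and `b = ⟨x, μ⟩` a fine bond CROSSING from `B(c₋)` to `B(c₊)`: `x = blockSite c₋ r` on the far face of `B(c₋)` (`r_μ = L − 1`).  If
every fine bond lying INSIDE `B(c₋)` or inside `B(c₊)` (both ends in the same block) is `τ`-close to `1` — the content of a block-wise axial gauge
with small plaquettes, [6] (1.15)∕(1.19), supplied by the consumer (pv26 `T4AxialGaugeSmallField.dist1_gaugeAct_axialGauge_le` per block) — then
`dist1 (U(b)) ≤ dist1 (U(Γ ∪ [x, x′] ∪ (−Γ′))) + (d + 1)(L − 1)·τ` for the (0.4)-family transporter through `x` (any orderings `σ, σ′`): the staircase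
`Γ` has at most `d(L−1)∕2` bonds inside `B(c₋)`, the run `[x + e_μ, x′]` has `L − 1` bonds inside `B(c₊)`, the staircase `Γ′` at most `d(L−1)∕2` bonds
inside `B(c₊)`.  Print: «Thus |R(V₀(Γ_{b₀,−,b₋}))V′_b − V′_{b₀}| < (d−1)(L−1)4dα₀L⁻¹ … for an arbitrary bond b ∈ B(c)», here at `V₀ = 1` with the tree's counts.
[cite: Balaban1985RegularSpaces, Lemma 1 (1.25) p.79, p.80 l.1-4; Balaban1987RG1, (0.3)-(0.4) pp.252-253] -/
theorem dist1_crossingBond_le_openHol_add (hj : j + 1 ≤ P.m + P.K) (U : GaugeField P j G) (c : PBond P (j + 1))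
    (r : Fin P.d → Fin P.L) (hr : (r c.dir : ℕ) = P.L - 1) (σ σ' : Equiv.Perm (Fin P.d)) {τ : ℝ} (hτ : 0 ≤ τ)
    (hint : ∀ b : PBond P j, blockOf b.src = blockOf b.tgt → (blockOf b.src = c.src ∨ blockOf b.src = c.tgt) → dist1 (U b) ≤ τ) :
    dist1 (U ⟨Site.blockSite c.src r, c.dir⟩) ≤
      dist1 (openHol U c (r, σ, σ')) + (((P.d + 1) * (P.L - 1) : ℕ) : ℝ) * τ := by
  have hL := AveragingRT.two_mul_half_add_one P
  have hL2 := P.hL.2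
  set n : Fin P.d → ℤ := off r with hn_def
  have hn : ∀ κ, -(((P.L - 1) / 2 : ℕ) : ℤ) ≤ n κ ∧ n κ ≤ (((P.L - 1) / 2 : ℕ) : ℤ) := off_bounds r
  have hμ : n c.dir = (((P.L - 1) / 2 : ℕ) : ℤ) := by
    simp only [hn_def, off, hr]
    omega
  -- coordinates of `x = blockSite c₋ r` relative to the centre of `B(c₋)`
  have hx : ∀ ν, Site.blockSite c.src r ν = emb c.src ν + ((n ν : ℤ) : ZMod (P.sitesPerDir j)) := by
    intro ν
    rw [← Summit.QuantumFields.BalabanUV.T4Continuum.Spine.NE7.walkEnd_emb_stairWord c.src σ r, walkEnd_apply, netDisp_stairWord]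
  -- the three pieces
  set A := holAt U (walk (emb c.src) (stairWord σ n)) with hA
  set C := holAt U (walk ((Site.blockSite c.src r).shift c.dir)
    (List.replicate (P.L - 1) (c.dir, true) ++ wordRev (stairWord σ' n))) with hC
  have hfac : openHol U c (r, σ, σ') = A * (U ⟨Site.blockSite c.src r, c.dir⟩ * C) := openHol_eq_mul_bond_mul U c r σ σ'
  -- `A`: every bond of `Γ` lies inside `B(c₋)`
  have hAle : dist1 A ≤ ((stairWord σ n).length : ℝ) * τ := by
    rw [hA, ← Summit.QuantumFields.BalabanUV.T4Continuum.B13AvgCorrStokesVariation.length_walk (emb c.src) (stairWord σ n)]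
    refine dist1_holAt_le_length_mul U hτ _ (fun s hs => ?_)
    obtain ⟨h1, h2⟩ := blockOf_src_tgt_of_mem_walk_stairWord hj c.src σ n hn hs
    exact hint s.bond (by rw [h1, h2]) (Or.inl h1)
  -- `C`: the run lies inside `B(c₊)`, and so does `Γ′` (bonds of the reversed walk are bonds of `Γ′`)
  have hCle : dist1 C ≤ ((List.replicate (P.L - 1) ((c.dir, true) : Letter P.d) ++ wordRev (stairWord σ' n)).length : ℝ) * τ := by
    rw [hC, ← Summit.QuantumFields.BalabanUV.T4Continuum.B13AvgCorrStokesVariation.length_walk ((Site.blockSite c.src r).shift c.dir)]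
    refine dist1_holAt_le_length_mul U hτ _ (fun s hs => ?_)
    rw [walk_append, List.mem_append] at hs
    rcases hs with hs | hs
    · obtain ⟨h1, h2⟩ := blockOf_src_tgt_of_mem_walk_run hj c n hn hμ hx hs
      exact hint s.bond (by rw [h1, h2]) (Or.inr h1)
    · rw [walkEnd_run_eq_walkEnd_stairWord c n σ' hx] at hs
      have hs' := flip_mem_walk_of_mem_walk_wordRev _ _ s hs
      obtain ⟨h1, h2⟩ := blockOf_src_tgt_of_mem_walk_stairWord hj c.tgt σ' n hn hs'
      exact hint s.bond (by rw [h1, h2]) (Or.inr h1)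
  -- lengths: `|Γ|, |Γ′| ≤ d·(L−1)/2`, the run has `L − 1`
  have hN : ∀ ν, (n ν).natAbs ≤ (P.L - 1) / 2 := fun ν => by have := hn ν; omega
  have hΓ : ((stairWord σ n).length : ℝ) ≤ (P.d * ((P.L - 1) / 2) : ℕ) := by
    exact_mod_cast LatticeWordStokes.length_stairWord_le σ n _ hN
  have hΓ' : ((List.replicate (P.L - 1) ((c.dir, true) : Letter P.d) ++ wordRev (stairWord σ' n)).length : ℝ) ≤
      ((P.L - 1 : ℕ) : ℝ) + (P.d * ((P.L - 1) / 2) : ℕ) := by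
    rw [List.length_append, List.length_replicate, Summit.QuantumFields.BalabanUV.T4Continuum.B13AvgCorrStokesLoop.length_wordRev]
    push_cast
    have := LatticeWordStokes.length_stairWord_le σ' n _ hN
    exact_mod_cast Nat.add_le_add_left this (P.L - 1)
  have hsum : ((P.d * ((P.L - 1) / 2) : ℕ) : ℝ) + (((P.L - 1 : ℕ) : ℝ) + (P.d * ((P.L - 1) / 2) : ℕ)) ≤
      (((P.d + 1) * (P.L - 1) : ℕ) : ℝ) := by
    have h2 : 2 * (P.d * ((P.L - 1) / 2)) + (P.L - 1) ≤ (P.d + 1) * (P.L - 1) := by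
      have : 2 * ((P.L - 1) / 2) = P.L - 1 := by omega
      nlinarith [this]
    exact_mod_cast (by linarith [(show ((2 * (P.d * ((P.L - 1) / 2)) + (P.L - 1) : ℕ) : ℝ) ≤ (((P.d + 1) * (P.L - 1) : ℕ) : ℝ)
      from by exact_mod_cast h2)]) 
  have hmid := dist1_mid_le A (U ⟨Site.blockSite c.src r, c.dir⟩) C
  rw [← hfac] at hmid
  have hA' : dist1 A ≤ ((P.d * ((P.L - 1) / 2) : ℕ) : ℝ) * τ := hAle.trans (mul_le_mul_of_nonneg_right hΓ hτ)
  have hC' : dist1 C ≤ (((P.L - 1 : ℕ) : ℝ) + (P.d * ((P.L - 1) / 2) : ℕ)) * τ := hCle.trans (mul_le_mul_of_nonneg_right hΓ' hτ)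
  have htot : dist1 A + dist1 C ≤ (((P.d + 1) * (P.L - 1) : ℕ) : ℝ) * τ := by
    have := mul_le_mul_of_nonneg_right hsum hτ
    linarith [this, hA', hC']
  linarith

end Crossing


/-! ## §6  The bond-keyed form: an arbitrary crossing bond is a far-face bond `⟨blockSite c₋ r, μ⟩`, `r_μ = L − 1` -/

section Offsets

variable {P : Params} {j : ℕ}

/-- Shifting a block site below the far face stays in the block: `blockSite y r + e_μ = blockSite y r′`, `r′_μ = r_μ + 1 < L`. [folklore] -/
theorem blockSite_shift_of_lt (y : Site P (j + 1)) (r : Fin P.d → Fin P.L) (μ : Fin P.d) (h : (r μ : ℕ) + 1 < P.L) :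
    (Site.blockSite y r).shift μ = Site.blockSite y (Function.update r μ ⟨(r μ : ℕ) + 1, h⟩) := by
  funext ν
  rw [Site.shift_apply]
  by_cases hν : ν = μ
  · subst hν
    simp only [if_true, Site.blockSite, Function.update_self]
    push_cast
    ring
  · rw [if_neg hν]
    simp only [Site.blockSite, Function.update_of_ne hν]

/-- **AN ARBITRARY CROSSING BOND IS A FAR-FACE BOND**: if `blockOf b₋ = c₋` and `blockOf b₊ ≠ c₋` (e.g. `= c₊`), with `b` in the direction of `c`,
then `b = ⟨blockSite c₋ r, μ⟩` for an offset `r` with `r_μ = L − 1` (`Site.blockEquiv`, standing range). [cite: Balaban1985RegularSpaces, (1.23) p.79] -/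
theorem exists_offset_of_crossing (hj : j + 1 ≤ P.m + P.K) (c : PBond P (j + 1)) (b : PBond P j) (hsrc : blockOf b.src = c.src)
    (hdir : b.dir = c.dir) (htgt : blockOf b.tgt ≠ c.src) :
    ∃ r : Fin P.d → Fin P.L, (r c.dir : ℕ) = P.L - 1 ∧ b = ⟨Site.blockSite c.src r, c.dir⟩ := by
  set r := Site.blockEquiv hj c.src ⟨b.src, hsrc⟩ with hr
  have hx : Site.blockSite c.src r = b.src := by
    have := (Site.blockEquiv hj c.src).left_inv ⟨b.src, hsrc⟩
    exact congrArg Subtype.val this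
  refine ⟨r, ?_, ?_⟩
  · by_contra hne
    have hlt : (r c.dir : ℕ) + 1 < P.L := by have := (r c.dir).isLt; omega
    apply htgt
    rw [PBond.tgt, hdir, ← hx, blockSite_shift_of_lt c.src r c.dir hlt, Site.blockOf_blockSite hj]
  · obtain ⟨src, dir⟩ := b
    simp only at hdir hx ⊢
    rw [← hx, hdir]

/-- ★★ **LEMMA 1 OF [6] (1.25), (0.4) READING, FOR AN ARBITRARY CROSSING BOND `b ∈ B(c)`** (`blockOf b₋ = c₋`, `blockOf b₊ = c₊`, `b ∥ c`), generic
gauge group, hypothesis-form block-wise gauge: `dist1 (U(b)) ≤ dist1 (U(Γ ∪ [b₋, b₋ + Le_μ] ∪ (−Γ′))) + (d+1)(L−1)·τ` for the (0.4)-family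
transporter through `b₋` (orderings `σ, σ′` free). [cite: Balaban1985RegularSpaces, Lemma 1 (1.25) p.79, p.80 l.1-4] -/
theorem dist1_crossingBond_le_openHol_add' (hj : j + 1 ≤ P.m + P.K) {G : Type*} [GaugeGroup G] (U : GaugeField P j G)
    (c : PBond P (j + 1)) (b : PBond P j) (hsrc : blockOf b.src = c.src) (hdir : b.dir = c.dir) (htgt : blockOf b.tgt = c.tgt)
    (σ σ' : Equiv.Perm (Fin P.d)) {τ : ℝ} (hτ : 0 ≤ τ)
    (hint : ∀ b' : PBond P j, blockOf b'.src = blockOf b'.tgt → (blockOf b'.src = c.src ∨ blockOf b'.src = c.tgt) → dist1 (U b') ≤ τ) :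
    ∃ r : Fin P.d → Fin P.L, (r c.dir : ℕ) = P.L - 1 ∧ b = ⟨Site.blockSite c.src r, c.dir⟩ ∧
      dist1 (U b) ≤ dist1 (openHol U c (r, σ, σ')) + (((P.d + 1) * (P.L - 1) : ℕ) : ℝ) * τ := by
  have hne : blockOf b.tgt ≠ c.src := by
    rw [htgt, PBond.tgt]
    intro h
    have h1 := congrFun h c.dir
    rw [Site.shift_apply, if_pos rfl] at h1
    have h2 : (1 : ZMod (P.sitesPerDir (j + 1))) = 0 := by linear_combination h1
    exact one_ne_zero h2
  obtain ⟨r, hr, hb⟩ := exists_offset_of_crossing hj c b hsrc hdir hne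
  refine ⟨r, hr, hb, ?_⟩
  rw [hb]
  exact dist1_crossingBond_le_openHol_add hj U c r hr σ σ' hτ hint

end Offsets

end Summit.QuantumFields.YangMills.BalabanUVNodes.N07Lemma1CrossingBonds

end
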